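import Literature.Topology.FourManifolds.TautFoliationsFences
import HarnessLib

/-!
# Sliding fences inside one flow box

Topic: codimension-one `C⁰` foliations, fences (`TautFoliationsFences.lean`). Let `c` be a flow
box of the atlas, `ψ` a continuous injective function on the level interval
`(τ₀ - ε, τ₀ + ε)` with inverse germ `φ` at `ψ τ₀`, and `T₁`, `T₂` two continuous *transversal
curves* in the box, parametrised by the level: `T₁ τ`, `T₂ τ` lie on the plaque of `c` at height
`ψ τ`. **Interpolating the leaf coordinates** of `T₁ τ` and `T₂ τ` at height `ψ τ`,
`Φ θ τ = c.symm ((1 - θ) (c (T₁ τ)).1 + θ (c (T₂ τ)).1, ψ τ)`, gives a fence over the whole unit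
interval, from the vertical `T₁` to the vertical `T₂` (`Φ 0 = T₁`, `Φ 1 = T₂`), for the germ path
`θ ↦ germ (φ ∘ h_c)` along the plaque segment from `T₁ τ₀` to `T₂ τ₀` (`IsFenceOn.slide`). This is
the elementary piece by which fences whose end verticals are prescribed transversals (the
verticals of the local models at the punctures of a planar foliation, the verticals of flow
boxes) are connected to each other inside one box.

* `slideB`, `slideFence`, `slideGerm`, `slidePath` (**definitions**);
* `slideFence_zero`, `slideFence_one`, `slideGerm_germ`, `ofLeafSpace_slideGerm_pt` (**proved**);
* `IsFenceOn.slide` (**proved**).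

## References

* C. Camacho, A. Lins Neto, *Geometric Theory of Foliations*, Birkhäuser (1985), Ch. IV §2
  [CamachoLinsNeto1985].
-/

noncomputable section

open Set Filter Function Topology unitInterval

namespace Literature.Topology.FourManifolds

namespace Foliation

variable {B : Type*} [NormedAddCommGroup B] [NormedSpace ℝ B] {M : Type*} [TopologicalSpace M] {F : Foliation B M}
variable {c : OpenPartialHomeomorph M (B × ℝ)} {τ₀ ε : ℝ} {φ ψ : ℝ → ℝ} {T₁ T₂ : ℝ → M}

/-! ## The interpolation -/

/-- The interpolated leaf coordinate at parameter `θ` and level `τ`. [folklore] -/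
def slideB (c : OpenPartialHomeomorph M (B × ℝ)) (T₁ T₂ : ℝ → M) (θ : I) (τ : ℝ) : B :=
  (1 - (θ : ℝ)) • (c (T₁ τ)).1 + (θ : ℝ) • (c (T₂ τ)).1

/-- **The sliding fence**: the point of the plaque at height `ψ τ` with the interpolated leaf
coordinate. [folklore] -/
def slideFence (c : OpenPartialHomeomorph M (B × ℝ)) (ψ : ℝ → ℝ) (T₁ T₂ : ℝ → M) (θ : I) (τ : ℝ) : M :=
  c.symm (slideB c T₁ T₂ θ τ, ψ τ)

/-- The interpolated leaf coordinate at `θ = 0`. [folklore] -/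
@[simp] theorem slideB_zero (c : OpenPartialHomeomorph M (B × ℝ)) (T₁ T₂ : ℝ → M) (τ : ℝ) :
    slideB c T₁ T₂ 0 τ = (c (T₁ τ)).1 := by
  simp [slideB]

/-- The interpolated leaf coordinate at `θ = 1`. [folklore] -/
@[simp] theorem slideB_one (c : OpenPartialHomeomorph M (B × ℝ)) (T₁ T₂ : ℝ → M) (τ : ℝ) :
    slideB c T₁ T₂ 1 τ = (c (T₂ τ)).1 := by
  simp [slideB]

/-- The interpolated leaf coordinate is continuous on `I × J` when the leaf coordinates of the two
curves are continuous on `J`. [folklore] -/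
theorem continuousOn_slideB {J : Set ℝ} (h₁ : ContinuousOn (fun τ ↦ (c (T₁ τ)).1) J)
    (h₂ : ContinuousOn (fun τ ↦ (c (T₂ τ)).1) J) :
    ContinuousOn (uncurry (slideB c T₁ T₂)) (univ ×ˢ J) := by
  have hθ : Continuous fun p : I × ℝ ↦ ((p.1 : I) : ℝ) := continuous_subtype_val.comp continuous_fst
  refine ((continuous_const.sub hθ).continuousOn.smul (h₁.comp continuousOn_snd fun p hp ↦ hp.2)).add
    (hθ.continuousOn.smul (h₂.comp continuousOn_snd fun p hp ↦ hp.2))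

/-! ## The germ path -/

/-- The germ of `φ ∘ h_c` at the points of the plaque segment at the base level. [folklore] -/
def slideGerm (hc : c ∈ F.atlas) (hφ : IsHomeoGermAt φ (ψ τ₀)) (T₁ T₂ : ℝ → M) (θ : I) : F.GermSpace :=
  F.germSection hc (ψ τ₀) hφ (slideB c T₁ T₂ θ τ₀)

/-- The germ path is continuous. [folklore] -/
theorem continuous_slideGerm (hc : c ∈ F.atlas) (hφ : IsHomeoGermAt φ (ψ τ₀)) (T₁ T₂ : ℝ → M) :
    Continuous (slideGerm hc hφ T₁ T₂) := by
  refine (F.continuous_germSection hc (ψ τ₀) hφ).comp ?_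
  exact ((continuous_const.sub continuous_subtype_val).smul continuous_const).add
    (continuous_subtype_val.smul continuous_const)

/-- The germs of the germ path. [folklore] -/
@[simp] theorem slideGerm_germ (hc : c ∈ F.atlas) (hφ : IsHomeoGermAt φ (ψ τ₀)) (T₁ T₂ : ℝ → M) (θ : I) :
    (slideGerm hc hφ T₁ T₂ θ).germ = ↑(φ ∘ height c) := rfl

/-- The base points of the germ path. [folklore] -/
theorem ofLeafSpace_slideGerm_pt (hc : c ∈ F.atlas) (hφ : IsHomeoGermAt φ (ψ τ₀)) (T₁ T₂ : ℝ → M) (θ : I) :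
    ofLeafSpace (slideGerm hc hφ T₁ T₂ θ).pt = c.symm (slideB c T₁ T₂ θ τ₀, ψ τ₀) := rfl

/-- The germ path, as a path of the germ space. [folklore] -/
def slidePath (hc : c ∈ F.atlas) (hφ : IsHomeoGermAt φ (ψ τ₀)) (T₁ T₂ : ℝ → M) :
    Path (slideGerm hc hφ T₁ T₂ 0) (slideGerm hc hφ T₁ T₂ 1) where
  toFun := slideGerm hc hφ T₁ T₂
  continuous_toFun := continuous_slideGerm hc hφ T₁ T₂
  source' := rfl
  target' := rfl

/-- The values of the germ path. [folklore] -/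
@[simp] theorem slidePath_apply (hc : c ∈ F.atlas) (hφ : IsHomeoGermAt φ (ψ τ₀)) (T₁ T₂ : ℝ → M) (θ : I) :
    slidePath hc hφ T₁ T₂ θ = slideGerm hc hφ T₁ T₂ θ := rfl

/-- The initial germ of the germ path is the germ of `φ ∘ h_c` at `T₁ τ₀`. [folklore] -/
theorem ofLeafSpace_slideGerm_pt_zero (hc : c ∈ F.atlas) (hφ : IsHomeoGermAt φ (ψ τ₀))
    (h₁ : T₁ τ₀ ∈ plaque c (ψ τ₀)) : ofLeafSpace (slideGerm hc hφ T₁ T₂ 0).pt = T₁ τ₀ := by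
  rw [ofLeafSpace_slideGerm_pt, slideB_zero, ← h₁.2]
  exact c.left_inv h₁.1

/-- The final germ of the germ path is the germ of `φ ∘ h_c` at `T₂ τ₀`. [folklore] -/
theorem ofLeafSpace_slideGerm_pt_one (hc : c ∈ F.atlas) (hφ : IsHomeoGermAt φ (ψ τ₀))
    (h₂ : T₂ τ₀ ∈ plaque c (ψ τ₀)) : ofLeafSpace (slideGerm hc hφ T₁ T₂ 1).pt = T₂ τ₀ := by
  rw [ofLeafSpace_slideGerm_pt, slideB_one, ← h₂.2]
  exact c.left_inv h₂.1

/-! ## The sliding fence is a fence -/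

/-- The sliding fence at `θ = 0` is `T₁`. [folklore] -/
theorem slideFence_zero {τ : ℝ} (h₁ : T₁ τ ∈ plaque c (ψ τ)) : slideFence c ψ T₁ T₂ 0 τ = T₁ τ := by
  rw [slideFence, slideB_zero, ← h₁.2]
  exact c.left_inv h₁.1

/-- The sliding fence at `θ = 1` is `T₂`. [folklore] -/
theorem slideFence_one {τ : ℝ} (h₂ : T₂ τ ∈ plaque c (ψ τ)) : slideFence c ψ T₁ T₂ 1 τ = T₂ τ := by
  rw [slideFence, slideB_one, ← h₂.2]
  exact c.left_inv h₂.1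

/-- The sliding fence lies on the plaque at height `ψ τ`. [folklore] -/
theorem slideFence_mem_plaque (hc : c ∈ F.atlas) (θ : I) (τ : ℝ) :
    slideFence c ψ T₁ T₂ θ τ ∈ plaque c (ψ τ) := by
  have ht : (slideB c T₁ T₂ θ τ, ψ τ) ∈ c.target := by rw [F.target_eq c hc]; exact mem_univ _
  refine ⟨c.map_target ht, ?_⟩
  show (c (c.symm _)).2 = _
  rw [c.right_inv ht]

/-- **The sliding fence is a fence** over the unit interval for the germ path `slideGerm`, from
`T₁` to `T₂`. [folklore] -/
theorem IsFenceOn.slide (hc : c ∈ F.atlas) (hφ : IsHomeoGermAt φ (ψ τ₀))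
    (hψc : ContinuousOn ψ (Ioo (τ₀ - ε) (τ₀ + ε))) (hψi : InjOn ψ (Ioo (τ₀ - ε) (τ₀ + ε)))
    (hφψ : ∀ τ ∈ Ioo (τ₀ - ε) (τ₀ + ε), φ (ψ τ) = τ) (hψφ : ∀ᶠ r in 𝓝 (ψ τ₀), ψ (φ r) = r)
    (hT₁ : ContinuousOn T₁ (Ioo (τ₀ - ε) (τ₀ + ε))) (hT₂ : ContinuousOn T₂ (Ioo (τ₀ - ε) (τ₀ + ε)))
    (h₁ : ∀ τ ∈ Ioo (τ₀ - ε) (τ₀ + ε), T₁ τ ∈ plaque c (ψ τ)) (h₂ : ∀ τ ∈ Ioo (τ₀ - ε) (τ₀ + ε), T₂ τ ∈ plaque c (ψ τ))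
    (hε : 0 < ε) :
    IsFenceOn F (slidePath hc hφ T₁ T₂) τ₀ ε (slideFence c ψ T₁ T₂) univ := by
  have hτ₀ : τ₀ ∈ Ioo (τ₀ - ε) (τ₀ + ε) := ⟨by linarith, by linarith⟩
  -- continuity of the leaf coordinates of the two curves
  have hc₁ : ContinuousOn (fun τ ↦ (c (T₁ τ)).1) (Ioo (τ₀ - ε) (τ₀ + ε)) :=
    continuous_fst.comp_continuousOn (c.continuousOn.comp hT₁ fun τ hτ ↦ (h₁ τ hτ).1)
  have hc₂ : ContinuousOn (fun τ ↦ (c (T₂ τ)).1) (Ioo (τ₀ - ε) (τ₀ + ε)) :=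
    continuous_fst.comp_continuousOn (c.continuousOn.comp hT₂ fun τ hτ ↦ (h₂ τ hτ).1)
  -- the global local datum
  let D : LocalDatum F (slidePath hc hφ T₁ T₂) τ₀ ε (univ ∩ univ) :=
    { box := c
      box_mem := hc
      φ := φ
      ψ := ψ
      germ_eq := fun θ _ ↦ slideGerm_germ hc hφ T₁ T₂ θ
      pt_mem := fun θ _ ↦ by
        rw [slidePath_apply, ofLeafSpace_slideGerm_pt]
        exact slideFence_mem_plaque (T₁ := T₁) (T₂ := T₂) hc θ τ₀
      φ_ψ := hφψ
      ψ_φ := hψφ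
      ψ_cont := hψc
      ψ_inj := hψi }
  refine ⟨?_, fun θ _ ↦ ?_, fun θ _ ↦ ⟨univ, univ_mem, D, fun θ' _ τ hτ ↦ ?_⟩⟩
  · -- continuity
    have hB := continuousOn_slideB hc₁ hc₂
    have h : ContinuousOn (fun p : I × ℝ ↦ c.symm (uncurry (slideB c T₁ T₂) p, ψ p.2)) (univ ×ˢ Ioo (τ₀ - ε) (τ₀ + ε)) :=
      (F.continuous_symm_of_mem hc).comp_continuousOn (hB.prodMk (hψc.comp continuousOn_snd fun p hp ↦ hp.2))
    exact h
  · -- base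
    rfl
  · exact slideFence_mem_plaque hc θ' τ

end Foliation

end Literature.Topology.FourManifolds
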